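import Literature.Claims.NS.Jha2018
import Mathlib.Analysis.SpecialFunctions.Trigonometric.Basic
import HarnessLib

/-!
# C65 `Jha2018` — refutation certificates against the claim skeleton `Literature.Claims.NS.Jha2018`

Text of record: M. K. Jha, «The complete Solution for existence and smoothness of Navier-Stokes
equation», OSF Preprints gmh4n (2018), doi:10.31227/osf.io/gmh4n, 7 image pages (PDF page = page;
transcription `sources/Jha2018/osf-gmh4n/TRANSCRIPT.md`, lit-3 g2). Skeleton p485854 (typist-9 g2):
`claim_of_steps : Step1_EnergyLaw → Step2_Case1 → Step3_Case2_defined → Step4_InOtherWords →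
ClaimedTheorem`, `ClaimedTheorem := clayR3.Regularity` (Conclusion p.5–6 is Fefferman's (A) sentence).

This file is typist-9 g2's kernel kit (claims/Jha2018/SoloRefuteJha2018.typist9-kit.lean, sha16
b4c6f3cd135637be), adopted by the refuter of record (refuter-3) with this module docstring and no change
of content:

* `not_Step1_EnergyLaw` — FIRST LOAD-BEARING STEP, the «energy» law (4)–(7) p.2 / (11) p.3
  `V = √((2/ρ)F² + (V⁰)²)` asserted for every motion obeying Newton's law (4) `ρ dV/dt = F`: uniformly
  accelerated motion `ρ = 1`, `F ≡ 1`, `V(t) = t` obeys (4), and (11) at `t = 0` reads `0 = √2`.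
  (Indeed (11) at `t = 0` forces `F(0) = 0` for every motion; the work–energy theorem reads
  `(ρ/2)(V² − (V⁰)²) = ∫ F ds`, not `F²`.)
* `not_Step2_Case1` — (15) p.4: the displayed Case-1 speed has `V(0) = √(2/ρ)·e⁰ = √(2/ρ) ≠ 0 = V⁰`.
* `not_Step3_Case2_defined` — (20) p.5 `V = V⁰ sec(t/(√2 ρ^{3/2}))` with «at any particular time, there
  always exist a defined value of velocity»: at `ρ = 1`, `t* = (π/2)√2` the cosine vanishes.

Step 4 (`Step4_InOtherWords`, Conclusion p.5–6) is the STATEMENT-level bridge from two scalar speed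
formulas to (A): no velocity field / pressure solving (1)–(3) is written (Δ2 no continuity equation, Δ3
gravity kept, Δ5 `x`-independent speed — `Literature.Claims.NS.Jha2018.delta5_uniformField`); as typed
it is an implication with a kernel-false antecedent. `ClaimedTheorem` = (A) itself is not kernel-decidable.

WHAT THIS IS NOT: not a claim about NS regularity or blow-up; not a claim about any author beyond the
typed locator.
-/

noncomputable section

-- the cell's Theorems namespace repeats the summit name (convention); silence the duplicate-namespace linter
set_option linter.dupNamespace false

namespace Summit.NavierStokesRegularity.NavierStokesRegularity.Theorems.Jha2018

open Literature.Claims.NS.Jha2018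

/-- **`¬ Step 1`**: uniformly accelerated motion. [cite: Jha2018, (4)–(7) p.2, (11) p.3] -/
theorem not_Step1_EnergyLaw : ¬ Literature.Claims.NS.Jha2018.Step1_EnergyLaw := by
  intro h
  have hd : ∀ t : ℝ, HasDerivAt (fun s : ℝ => s) ((fun _ : ℝ => (1 : ℝ)) t / 1) t := fun t => by
    rw [div_one]
    exact hasDerivAt_id' t
  have h0 := h 1 one_pos (fun s => s) (fun _ => 1) hd 0 le_rfl
  have h2 : Real.sqrt (2 / 1 * (1 : ℝ) ^ 2 + (0 : ℝ) ^ 2) = Real.sqrt 2 := by norm_num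
  rw [h2] at h0
  have : (0 : ℝ) < Real.sqrt 2 := Real.sqrt_pos.mpr (by norm_num)
  linarith

/-- **`¬ Step 2`**: `V(0) = √(2/ρ)·e⁰ = √(2/ρ) > 0`. [cite: Jha2018, (15) p.4] -/
theorem not_Step2_Case1 : ¬ Literature.Claims.NS.Jha2018.Step2_Case1 := by
  intro h
  have h1 := h 1 one_pos
  simp only [speedCase1, zero_div, Real.exp_zero, mul_one, div_one] at h1
  have : (0 : ℝ) < Real.sqrt 2 := Real.sqrt_pos.mpr (by norm_num)
  linarith

/-- **`¬ Step 3`**: at `ρ = 1`, `t* = (π/2)·√2 ≥ 0` the phase is `π/2` and `cos(π/2) = 0` — the secant of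
(20) is undefined there. [cite: Jha2018, (20) p.5] -/
theorem not_Step3_Case2_defined : ¬ Literature.Claims.NS.Jha2018.Step3_Case2_defined := by
  intro h
  have hs : (0 : ℝ) < Real.sqrt 2 := Real.sqrt_pos.mpr (by norm_num)
  have ht : (0 : ℝ) ≤ Real.pi / 2 * Real.sqrt 2 := by positivity
  have h1 := h 1 one_pos 1 one_ne_zero (Real.pi / 2 * Real.sqrt 2) ht
  apply h1
  simp only [phase, Real.one_rpow, mul_one]
  rw [mul_div_assoc, div_self hs.ne', mul_one, Real.cos_pi_div_two]

end Summit.NavierStokesRegularity.NavierStokesRegularity.Theorems.Jha2018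

end

-- WHAT THIS IS NOT: not a claim about NS regularity or blow-up; not a claim about any author beyond the typed locator.
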